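/-
Copyright: statement-level skeleton of a published paper (lit-balaban cell, Phase-2 proof seat p13, gen 6). No proof
claims beyond what the kernel checks below.
-/
import Literature.MathematicalPhysics.QuantumFieldTheory.Balaban1983to89.B4Sect5CubeBounds
import Literature.MathematicalPhysics.QuantumFieldTheory.BalabanImbrieJaffe1984to88.BIJ88Sect2Statements

/-!
# `BalabanImbrieJaffe1984to88.BIJ88ConvexWeights227` — T. Bałaban, J. Imbrie, A. Jaffe, *Effective action and cluster
properties of the abelian Higgs model*, Commun. Math. Phys. **114** (1988) 257–315 [BalabanImbrieJaffe1988], §2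
(2.27) p. 263 [PDF 7]: **the convex weights `λ_α` of (2.27) CONSTRUCTED "as in [6]"** ([6] =
[Balaban1983RegularityDecay], the partition of unity `h_j`, `Σ_j h_j² = 1`, of its §2/§5) — with every printed
property PROVED: a convex combination, varying smoothly with `(x₁+x₂)/2`, at most `2^d` terms, concentrated on `□_α`
when `(x₁+x₂)/2` is near the centre of `□_α`.

statement-level skeleton of published theorems with citation tags; proofs where landed; nothing here is a claim
about the Yang–Mills mass gap

PDF held: `paper:balaban1988-cmp114-bij-abelian-higgs-effective-action` (journal page = PDF page + 256; p. 263
read with `lit read … --pages 7`).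

CITATION HEADER (lean-in-tree rule).  lit-balaban cell (HOME `run/shared/lean/pub/lit-balaban/`), Phase 2, seat p13
gen 6 (unit `lit-balaban-p13-g6`); row **C2.Eq2.27** (DEF) of `HOME/lit-balaban-r18/ROWS-C2.md` (owner r18, referee
ref-5; typed `BIJ88Sect2Statements.convexComb` / `IsConvexWeights`, p239939; the hypothesis `IsConvexWeights w` of
`BIJ88OpDecay230Proof.abs_convexComb_le` / `abs_convexComb_sub_le`, p02 g3 p248817, is DISCHARGED here by a concrete
`w`).  Files USED BY NAME, nothing restated: `…B4Sect5CubeBounds` (p245229: the [6] profile `prof` and partition `hfun`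
with `prof_of_abs_le`, `prof_of_le_abs`, `hfun_nonneg`, `hfun_le_one`, `abs_hfun_sub_le`, `cand`, `card_cand`,
`hfun_eq_zero_of_not_mem_cand`, `sum_hfun_sq`), `…BIJ88Sect2Statements` (`convexComb`, `IsConvexWeights`).

## The print (verbatim, p. 263)

*"Let {□_α} be the collection of (1/2L) r(e_{k−1})-cubes that can be built from cubes of size M = O(1) as in [6].
Define G̃_k(u; x₁, x₂) = Σ_α λ_αG_k(□_α, u; x₁, x₂) (2.27) as a convex combination of Neumann propagators. The convex
combination varies smoothly with (x₁ + x₂)/2; it involves at most 2^d terms and is concentrated on □_α when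
(x₁ + x₂)/2 is near the center of □_α."*

## What is constructed and proved

On `ℤ^d`, with cubes labelled by `α ∈ ℤ^d` at spacing `s` lattice units (`s` = the side `(1/2L)r(e_{k−1})` in lattice
units; centre of `□_α` = `sα`), the weight of `□_α` at `(x₁, x₂)` is [6]'s partition function at the midpoint,
squared: `λ_α(x₁,x₂) = h_α((x₁+x₂)/2)² = Π_μ h(((x₁+x₂)_μ/2 − sα_μ)/s)²`, realised WITHOUT leaving the lattice as
`hfun (2s) α (x₁ + x₂)²` (`cwt`).  PROVED: `0 ≤ λ_α ≤ 1` (`cwt_nonneg`, `cwt_le_one`); *"convex combination"*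
`Σ_α λ_α(x₁,x₂) = 1` over every finite label set containing the `2^d` candidate labels of the midpoint (`sum_cwt`),
packaged as r18's `IsConvexWeights` on every finite volume (`isConvexWeights_cwt`, label set `mlabels`); *"at most 2^d
terms"* (`card_support_cwt_le`); *"concentrated on □_α when (x₁+x₂)/2 is near the center of □_α"*: `λ_α = 1` when
the midpoint is within `s/3` of the centre `sα` in every coordinate (`cwt_eq_one_of_near_center`) and `λ_α = 0` when
it is at least `2s/3` away in some coordinate (`cwt_eq_zero_of_far`); *"varies smoothly with (x₁+x₂)/2"*: Lipschitz
in the midpoint, `|λ_α(x₁,x₂) − λ_α(y₁,y₂)| ≤ (3πd/(2s))·|(x₁+x₂) − (y₁+y₂)|_∞` (`abs_cwt_sub_le`; modulus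
`O(s^{−1}) = O(L/r(e_{k−1}))`).  HONEST SCOPE: the weights only; the propagators `G_k(□_α, u)` and the cubes as unions of
`M`-cubes are not constructed here (any family `G` can be fed to `convexComb (cwt …) G`).  No `sorry`; no new `Prop` fact.
-/

namespace Literature.MathematicalPhysics.QuantumFieldTheory.BalabanImbrieJaffe1984to88.BIJ88ConvexWeights227

open scoped BigOperators
open Finset Real
open Literature.MathematicalPhysics.QuantumFieldTheory.Balaban1983to89
open Literature.MathematicalPhysics.QuantumFieldTheory.BalabanImbrieJaffe1984to88
open B4Sect5CubeBounds BIJ88Sect2Statements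

variable {d : ℕ}

/-! ## §1 The weights `λ_α(x₁, x₂) = h_α((x₁+x₂)/2)²` -/

/-- **the convex weight of the cube `□_α` at `(x₁, x₂)`** ((2.27), *"as in [6]"*): [6]'s partition function at the
midpoint, squared — `λ_α(x₁,x₂) = Π_μ h(((x₁+x₂)_μ/2 − sα_μ)/s)² = hfun (2s) α (x₁+x₂)²` (cube spacing `s` lattice
units, centre of `□_α` at `sα`). [cite: BalabanImbrieJaffe1988, (2.27) p.263] -/
noncomputable def cwt (s : ℕ) (α x₁ x₂ : Fin d → ℤ) : ℝ := hfun (2 * s) α (x₁ + x₂) ^ 2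

/-- `0 ≤ λ_α`. [cite: BalabanImbrieJaffe1988, (2.27) p.263] -/
theorem cwt_nonneg (s : ℕ) (α x₁ x₂ : Fin d → ℤ) : 0 ≤ cwt s α x₁ x₂ := sq_nonneg _

/-- `λ_α ≤ 1`. [cite: BalabanImbrieJaffe1988, (2.27) p.263] -/
theorem cwt_le_one (s : ℕ) (α x₁ x₂ : Fin d → ℤ) : cwt s α x₁ x₂ ≤ 1 := by
  unfold cwt
  have h0 := hfun_nonneg (2 * s) α (x₁ + x₂)
  have h1 := hfun_le_one (2 * s) α (x₁ + x₂)
  nlinarith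

/-- the weights depend on `(x₁, x₂)` only through `x₁ + x₂`, i.e. through the midpoint `(x₁+x₂)/2`.
[cite: BalabanImbrieJaffe1988, (2.27) p.263] -/
theorem cwt_eq_of_add_eq (s : ℕ) (α : Fin d → ℤ) {x₁ x₂ y₁ y₂ : Fin d → ℤ} (h : x₁ + x₂ = y₁ + y₂) :
    cwt s α x₁ x₂ = cwt s α y₁ y₂ := by
  unfold cwt
  rw [h]

/-- the weights are symmetric in `(x₁, x₂)`. [cite: BalabanImbrieJaffe1988, (2.27) p.263] -/
theorem cwt_comm (s : ℕ) (α x₁ x₂ : Fin d → ℤ) : cwt s α x₁ x₂ = cwt s α x₂ x₁ :=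
  cwt_eq_of_add_eq s α (add_comm x₁ x₂)

/-! ## §2 *"a convex combination"*: `Σ_α λ_α = 1` -/

/-- **`Σ_α λ_α(x₁, x₂) = 1`** over every finite label set containing the `2^d` candidate labels of the midpoint
(`cand (2s) (x₁+x₂)`) — [6]'s `Σ_j h_j² = 1`. [cite: BalabanImbrieJaffe1988, (2.27) p.263; Balaban1983RegularityDecay, p.575] -/
theorem sum_cwt (s : ℕ) (x₁ x₂ : Fin d → ℤ) (J : Finset (Fin d → ℤ)) (hJ : cand (2 * s) (x₁ + x₂) ⊆ J) :
    ∑ α ∈ J, cwt s α x₁ x₂ = 1 :=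
  sum_hfun_sq (2 * s) (x₁ + x₂) J hJ

/-- `λ_α(x₁, x₂) = 0` unless `α` is one of the `2^d` candidate labels of the midpoint. [cite: BalabanImbrieJaffe1988,
(2.27) p.263] -/
theorem cwt_eq_zero_of_not_mem_cand {s : ℕ} {α x₁ x₂ : Fin d → ℤ} (h : α ∉ cand (2 * s) (x₁ + x₂)) :
    cwt s α x₁ x₂ = 0 := by
  unfold cwt
  rw [hfun_eq_zero_of_not_mem_cand h, zero_pow two_ne_zero]

/-- **"it involves at most 2^d terms"**: at every `(x₁, x₂)` at most `2^d` weights are nonzero, whatever the label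
set. [cite: BalabanImbrieJaffe1988, (2.27) p.263] -/
theorem card_support_cwt_le (s : ℕ) (x₁ x₂ : Fin d → ℤ) (J : Finset (Fin d → ℤ)) :
    (J.filter fun α => cwt s α x₁ x₂ ≠ 0).card ≤ 2 ^ d := by
  rw [← card_cand (2 * s) (x₁ + x₂)]
  refine Finset.card_le_card fun α hα => ?_
  rw [Finset.mem_filter] at hα
  by_contra hn
  exact hα.2 (cwt_eq_zero_of_not_mem_cand hn)

/-! ## §3 *"concentrated on □_α when (x₁+x₂)/2 is near the center of □_α"* -/

/-- [6]'s `h_j(x) = 1` when `|x_μ/M − j_μ| ≤ 1/3` for every `μ` (*"h = 1 on [−1/3, 1/3]"*, p. 575). [cite: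
Balaban1983RegularityDecay, p.575] -/
theorem hfun_eq_one_of_abs_le {M : ℕ} {j x : Fin d → ℤ} (h : ∀ μ, |(x μ : ℝ) / M - j μ| ≤ 1 / 3) :
    hfun M j x = 1 := by
  unfold hfun
  exact Finset.prod_eq_one fun μ _ => prof_of_abs_le (h μ)

/-- **`λ_α = 1` near the centre**: if the midpoint `(x₁+x₂)/2` is within `s/3` of the centre `sα` in every
coordinate, then `λ_α(x₁, x₂) = 1` (and so every other weight vanishes there). [cite: BalabanImbrieJaffe1988, (2.27) p.263] -/
theorem cwt_eq_one_of_near_center {s : ℕ} (hs : 0 < s) {α x₁ x₂ : Fin d → ℤ}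
    (h : ∀ μ, |((x₁ + x₂) μ : ℝ) / 2 - s * α μ| ≤ s / 3) : cwt s α x₁ x₂ = 1 := by
  unfold cwt
  rw [hfun_eq_one_of_abs_le, one_pow]
  intro μ
  have hsr : (0 : ℝ) < s := by exact_mod_cast hs
  have hμ := h μ
  have key : ((x₁ + x₂) μ : ℝ) / ((2 * s : ℕ) : ℝ) - α μ = (((x₁ + x₂) μ : ℝ) / 2 - s * α μ) / s := by
    push_cast
    field_simp
  rw [key, abs_div, abs_of_pos hsr, div_le_iff₀ hsr]
  linarith

/-- **`λ_α = 0` away from `□_α`**: if in some coordinate the midpoint is at least `2s/3` from the centre `sα`, then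
`λ_α(x₁, x₂) = 0` (*"h ∈ C₀(]−2/3, 2/3[)"* of [6]). [cite: BalabanImbrieJaffe1988, (2.27) p.263] -/
theorem cwt_eq_zero_of_far {s : ℕ} (hs : 0 < s) {α x₁ x₂ : Fin d → ℤ} {μ : Fin d}
    (h : 2 * s / 3 ≤ |((x₁ + x₂) μ : ℝ) / 2 - s * α μ|) : cwt s α x₁ x₂ = 0 := by
  unfold cwt hfun
  rw [Finset.prod_eq_zero (Finset.mem_univ μ), zero_pow two_ne_zero]
  apply prof_of_le_abs
  have hsr : (0 : ℝ) < s := by exact_mod_cast hs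
  have key : ((x₁ + x₂) μ : ℝ) / ((2 * s : ℕ) : ℝ) - α μ = (((x₁ + x₂) μ : ℝ) / 2 - s * α μ) / s := by
    push_cast
    field_simp
  rw [key, abs_div, abs_of_pos hsr, le_div_iff₀ hsr]
  linarith

/-! ## §4 *"varies smoothly with (x₁+x₂)/2"*: Lipschitz in the midpoint -/

/-- **Lipschitz continuity in the midpoint**: `|λ_α(x₁,x₂) − λ_α(y₁,y₂)| ≤ (3πd/(2s))·|(x₁+x₂) − (y₁+y₂)|_∞` — i.e.
`≤ (3πd/s)·|midpoint − midpoint′|_∞`, modulus `O(s^{−1})` ([6]'s `|h_j(x) − h_j(x′)| ≤ (3πd/2M)|x − x′|` with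
`M = 2s`, and `|a² − b²| ≤ 2|a − b|` for `a, b ∈ [0,1]`). [cite: BalabanImbrieJaffe1988, (2.27) p.263] -/
theorem abs_cwt_sub_le {s : ℕ} (hs : 0 < s) (α x₁ x₂ y₁ y₂ : Fin d → ℤ) :
    |cwt s α x₁ x₂ - cwt s α y₁ y₂| ≤ 3 * π * d / (2 * s) * dist (x₁ + x₂) (y₁ + y₂) := by
  unfold cwt
  set a := hfun (2 * s) α (x₁ + x₂) with ha
  set b := hfun (2 * s) α (y₁ + y₂) with hb
  have h2s : 0 < 2 * s := by omega
  have hab : |a - b| ≤ 3 * π * d / (2 * ((2 * s : ℕ) : ℝ)) * dist (x₁ + x₂) (y₁ + y₂) :=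
    abs_hfun_sub_le h2s α (x₁ + x₂) (y₁ + y₂)
  have ha0 : 0 ≤ a := hfun_nonneg _ _ _
  have ha1 : a ≤ 1 := hfun_le_one _ _ _
  have hb0 : 0 ≤ b := hfun_nonneg _ _ _
  have hb1 : b ≤ 1 := hfun_le_one _ _ _
  have hsum : |a + b| ≤ 2 := by rw [abs_of_nonneg (by linarith)]; linarith
  have hdist : 0 ≤ dist (x₁ + x₂) (y₁ + y₂) := dist_nonneg
  have hsr : (0 : ℝ) < s := by exact_mod_cast hs
  calc |a ^ 2 - b ^ 2| = |a + b| * |a - b| := by rw [sq_sub_sq, abs_mul]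
    _ ≤ 2 * (3 * π * d / (2 * ((2 * s : ℕ) : ℝ)) * dist (x₁ + x₂) (y₁ + y₂)) :=
        mul_le_mul hsum hab (abs_nonneg _) (by norm_num)
    _ = 3 * π * d / (2 * s) * dist (x₁ + x₂) (y₁ + y₂) := by
        push_cast
        field_simp

/-! ## §5 The typed predicate `IsConvexWeights` inhabited on every finite volume -/

/-- the label set serving a finite volume `Λ`: all candidate labels of all midpoints of pairs of points of `Λ`.
[cite: BalabanImbrieJaffe1988, (2.27) p.263] -/
noncomputable def mlabels (s : ℕ) (Λ : Finset (Fin d → ℤ)) : Finset (Fin d → ℤ) :=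
  Λ.biUnion fun x₁ => Λ.biUnion fun x₂ => cand (2 * s) (x₁ + x₂)

/-- every candidate label of a midpoint of `Λ` is served. [cite: BalabanImbrieJaffe1988, (2.27) p.263] -/
theorem cand_subset_mlabels (s : ℕ) {Λ : Finset (Fin d → ℤ)} {x₁ x₂ : Fin d → ℤ} (h₁ : x₁ ∈ Λ) (h₂ : x₂ ∈ Λ) :
    cand (2 * s) (x₁ + x₂) ⊆ mlabels s Λ := by
  intro α hα
  exact Finset.mem_biUnion.mpr ⟨x₁, h₁, Finset.mem_biUnion.mpr ⟨x₂, h₂, hα⟩⟩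

/-- **(2.27)'s `IsConvexWeights` INHABITED**: on every finite volume `Λ ⊂ ℤ^d`, for every finite label set `J`
containing the candidate labels of its midpoints (e.g. `mlabels s Λ`), the weights `λ_α(x₁,x₂)`, `α ∈ J`,
`x₁, x₂ ∈ Λ`, form a convex combination at every pair of points (r18's typed predicate for (2.27)).
[cite: BalabanImbrieJaffe1988, (2.27) p.263] -/
theorem isConvexWeights_cwt (s : ℕ) (Λ J : Finset (Fin d → ℤ))
    (hJ : ∀ x₁ ∈ Λ, ∀ x₂ ∈ Λ, cand (2 * s) (x₁ + x₂) ⊆ J) :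
    IsConvexWeights (fun (α : ↥J) (x₁ x₂ : ↥Λ) => cwt s α.1 x₁.1 x₂.1) := by
  refine ⟨fun α x₁ x₂ => cwt_nonneg s α.1 x₁.1 x₂.1, fun x₁ x₂ => ?_⟩
  rw [Finset.sum_coe_sort J (fun α => cwt s α x₁.1 x₂.1)]
  exact sum_cwt s x₁.1 x₂.1 J (hJ _ x₁.2 _ x₂.2)

/-- the canonical instance with the label set `mlabels s Λ`. [cite: BalabanImbrieJaffe1988, (2.27) p.263] -/
theorem isConvexWeights_cwt_mlabels (s : ℕ) (Λ : Finset (Fin d → ℤ)) :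
    IsConvexWeights (fun (α : ↥(mlabels s Λ)) (x₁ x₂ : ↥Λ) => cwt s α.1 x₁.1 x₂.1) :=
  isConvexWeights_cwt s Λ (mlabels s Λ) fun _ h₁ _ h₂ => cand_subset_mlabels s h₁ h₂

/-- **(2.27) WITH THESE WEIGHTS**: for ANY family of propagators `G_α` (the print's Neumann propagators
`G_k(□_α, u)`), `G̃_k = Σ_α λ_αG_α` (`convexComb`) is bounded at `(x₁, x₂)` by any common bound of the `G_α` whose
cube carries weight there — the hypothesis `IsConvexWeights` of the (2.30)/(2.31) mechanism discharged by construction.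
[cite: BalabanImbrieJaffe1988, (2.27) p.263] -/
theorem abs_convexComb_cwt_le (s : ℕ) (Λ J : Finset (Fin d → ℤ))
    (hJ : ∀ x₁ ∈ Λ, ∀ x₂ ∈ Λ, cand (2 * s) (x₁ + x₂) ⊆ J) (G : ↥J → ↥Λ → ↥Λ → ℝ) {x₁ x₂ : ↥Λ} {B : ℝ}
    (hG : ∀ α : ↥J, cwt s α.1 x₁.1 x₂.1 ≠ 0 → |G α x₁ x₂| ≤ B) :
    |convexComb (fun (α : ↥J) (y₁ y₂ : ↥Λ) => cwt s α.1 y₁.1 y₂.1) G x₁ x₂| ≤ B := by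
  have hw := isConvexWeights_cwt s Λ J hJ
  unfold convexComb
  have hsum : ∑ α : ↥J, cwt s α.1 x₁.1 x₂.1 = 1 := hw.2 x₁ x₂
  have hB : 0 ≤ B ∨ ∀ α : ↥J, cwt s α.1 x₁.1 x₂.1 = 0 := by
    by_cases h : ∃ α : ↥J, cwt s α.1 x₁.1 x₂.1 ≠ 0
    · obtain ⟨α, hα⟩ := h
      exact Or.inl ((abs_nonneg _).trans (hG α hα))
    · push Not at h
      exact Or.inr h
  rcases hB with hB | hzero
  · calc |∑ α : ↥J, cwt s α.1 x₁.1 x₂.1 * G α x₁ x₂| ≤ ∑ α : ↥J, |cwt s α.1 x₁.1 x₂.1 * G α x₁ x₂| :=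
          Finset.abs_sum_le_sum_abs _ _
      _ ≤ ∑ α : ↥J, cwt s α.1 x₁.1 x₂.1 * B := by
          refine Finset.sum_le_sum fun α _ => ?_
          rw [abs_mul, abs_of_nonneg (cwt_nonneg _ _ _ _)]
          by_cases hα : cwt s α.1 x₁.1 x₂.1 = 0
          · rw [hα, zero_mul, zero_mul]
          · exact mul_le_mul_of_nonneg_left (hG α hα) (cwt_nonneg _ _ _ _)
      _ = B := by rw [← Finset.sum_mul, hsum, one_mul]
  · exfalso
    have : ∑ α : ↥J, cwt s α.1 x₁.1 x₂.1 = 0 := Finset.sum_eq_zero fun α _ => hzero α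
    rw [this] at hsum
    exact zero_ne_one hsum

end Literature.MathematicalPhysics.QuantumFieldTheory.BalabanImbrieJaffe1984to88.BIJ88ConvexWeights227
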